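import Literature.MathematicalPhysics.QuantumFieldTheory.Balaban1983to89.B9Eq311L2Pairing

/-!
# `Balaban1983to89.B9Eq311TracePairing` — T. Bałaban, *Propagators for lattice gauge theories in a background field*, Commun. Math. Phys. **99**
# (1985) 389–434 [Balaban1985BackgroundPropagators] (3.11) p. 392 «X·Y = tr XY»: THE BILINEAR TRACE PAIRING of `𝔤ᶜ`-valued lattice functions,
# the pointwise involution `f ↦ f⋆`, and the BILINEAR TRANSPOSE `Tᵗ := (⋆T⋆)†` of an operator — the complex-BILINEAR (analytic) companion of
# the cell's sesquilinear `L²` reading `B9Eq311L2Pairing` (`⟪φ⁻¹X, φ⁻¹Y⟫ = τ(X*Y)`), needed wherever print's quadratic forms are extended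
# analytically to `𝔤ᶜ`-valued fields ([Balaban1985Variational] (27), (80): «It is analytic in A′ for A′ with values in the complexified algebra»)

statement-level skeleton of published theorems with citation tags; proofs where landed; nothing here is a claim
about the Yang–Mills mass gap

PDF held: `paper:balaban1985-cmp99-background-propagators` (journal page = PDF page + 388), p. 392; `paper:balaban1985-cmp102-variational-background`
(journal page = PDF page + 276), pp. 282, 290–291, read by this seat (2026-08-21) in the held text layers.

THE PRINT (verbatim).  [B9] p. 392 (3.11) context: *«… where X·Y = tr XY. Let us recall that the trace is normalized, i.e., tr 1 = 1.»*; p. 390: *«R(U)X =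
UXU⁻¹»*; p. 392: *«For U with values in the unitary group U(N) it is a hermitian operator.»*  [B11] p. 290 (80): *«It is analytic in A′ for A′ with
values in the complexified algebra and satisfying (77).»*; p. 282 (27): the pairing `⟨J, δA⟩` of a current with a variation.

WHY THIS FILE (cell context).  The pub-balaban NE9 chain types the Hessian `Δ^η(U)` ([B9] (3.10), `B9Eq310HessianOperator.hessOp`) as a
HERMITIAN operator on the sesquilinear `L²` space (`hessOp_isSymmetric_of_trace`).  The (L3) W-slot programme of the crew (`B11Eq80Current`,
leaf seat `…-leaf-05`: [Balaban1985Variational] (80) `V(A′) = … − ⟨A′, Δ_π HD(A′)⟩ + ½⟨HD(A′), Δ_π HD(A′)⟩ + …`) pairs currents with variations by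
the complex-BILINEAR trace pairing (27) `η^d Σ_b τ(K(b)·δ(b))` and asks of the letter `Δ_π` a BILINEAR symmetry.  A Hermitian operator is
bilinear-symmetric only together with a reality property; this file supplies the neutral tool instead: the bilinear transpose `Tᵗ`, for which
`(f, Tᵗg) = (Tf, g)` holds with NO hypothesis on `T`, so that `πᵗ Δ π` is bilinear-symmetric as soon as `Δ` is (sequel `B9Eq3119DeltaPiCarrier`).

WHAT IS DEFINED AND PROVED (sorry-free; no `Prop` placeholder; no inequality of the papers).
* §1 `starW φ f` (the pointwise involution `(f⋆)(b) = φ⁻¹((φ f(b))*)` of a `W`-valued lattice function along the fibre reading `φ : W ≃ₗ[ℂ] 𝔸`;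
  conjugate-linear, involutive), `realConj T := ⋆∘T∘⋆` (again `ℂ`-linear), **`tpair φ τ f g := Σ_b w(b)·τ(φf(b)·φg(b))`** (the bilinear trace
  pairing; `tpair_comm` for a tracial `τ`, `tpair_add_right`), **`tpair_eq_inner_starW`**: `(f, g) = ⟪f⋆, g⟫` under `⟪φ⁻¹X, φ⁻¹Y⟫ = τ(X*Y)`,
  **`inner_starW_left`**: `⟪f⋆, g⟫ = conj ⟪f, g⋆⟫` (anti-unitarity; `τ(X*) = conj τ(X)`, `τ(XY) = τ(YX)`).
* §2 **`btrans φ T := (realConj T)†`** — the TRANSPOSE for the bilinear pairing: **`tpair_btrans`**: `(f, Tᵗ g) = (T f, g)`.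
MODEL / DECLARED READINGS.  (M1) carriers = the cell's `B9Eq311L2Pairing.WL2 ℂ w W` (any finite index `ι`, positive weights `w`, Hilbert fibre `W`), the
fibre read in a `*`-algebra `𝔸` over `ℂ` along `φ`; `τ : 𝔸 →ₗ[ℂ] ℂ` the trace letter.  (M2) the structural letters `hφ` (norming), `hτ₁`, `hτ₂` (a
`*`-trace) are DISPLAYED hypotheses, as in `B9Eq310HessianHermitian`.  (M3) no estimate.
HONEST SCOPE.  [folklore] `*`-algebra bookkeeping; NOT summit progress (cell pub-balaban: NE9 NOT PRINTED / NOT PROVED; spine PROVED 0/9).  Filed by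
the pub-balaban NE9 leaf seat `b2b-balaban-t4-ne9-formalise-leaf-01` (gen 72) for the (L3) letter `Δ_π` (leaf-05's WORD W-ne9leaf05-g65-1); NEW file;
nothing modified.  Net new unproved facts: 0.
-/

noncomputable section

open scoped InnerProductSpace ComplexConjugate BigOperators

namespace Literature.MathematicalPhysics.QuantumFieldTheory.Balaban1983to89.B9Eq311TracePairing

open B9Eq311L2Pairing (WL2)

/-! ## §1 The pointwise involution `f ↦ f⋆` of `W`-valued lattice functions along `φ`, and the trace pairing -/

section Star

variable {𝔸 : Type*} [Ring 𝔸] [StarRing 𝔸] [Algebra ℂ 𝔸] [StarModule ℂ 𝔸]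
  {W : Type*} [NormedAddCommGroup W] [InnerProductSpace ℂ W] (φ : W ≃ₗ[ℂ] 𝔸) {ι : Type*} {w : ι → ℝ}

/-- **The pointwise involution `(f⋆)(b) := φ⁻¹((φ f(b))*)`** of a `W`-valued lattice function read in the `*`-algebra `𝔸` along `φ`
(print's fields are `𝔤`-valued, `X* = −X` for `X ∈ 𝔤 = u(N)`; the complexified fields `𝔤ᶜ ⊆ 𝔸` carry the involution of `𝔸`).
[cite: Balaban1985BackgroundPropagators, p.390, (3.11) p.392] -/
def starW (f : WL2 ℂ w W) : WL2 ℂ w W := (WL2.equiv ℂ w W).symm fun i => φ.symm (star (φ (WL2.equiv ℂ w W f i)))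

omit [StarModule ℂ 𝔸] in
/-- Unfolding. [cite: Balaban1985BackgroundPropagators, (3.11) p.392] -/
@[simp] theorem equiv_starW (f : WL2 ℂ w W) (i : ι) : WL2.equiv ℂ w W (starW φ f) i = φ.symm (star (φ (WL2.equiv ℂ w W f i))) := rfl

omit [StarModule ℂ 𝔸] in
/-- `φ ((f⋆)(b)) = (φ f(b))*`. [cite: Balaban1985BackgroundPropagators, (3.11) p.392] -/
@[simp] theorem apply_equiv_starW (f : WL2 ℂ w W) (i : ι) : φ (WL2.equiv ℂ w W (starW φ f) i) = star (φ (WL2.equiv ℂ w W f i)) := by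
  rw [equiv_starW, LinearEquiv.apply_symm_apply]

omit [StarModule ℂ 𝔸] in
/-- The involution is involutive. [cite: Balaban1985BackgroundPropagators, (3.11) p.392] -/
@[simp] theorem starW_starW (f : WL2 ℂ w W) : starW φ (starW φ f) = f := by
  apply (WL2.equiv ℂ w W).injective
  funext i
  rw [equiv_starW, apply_equiv_starW, star_star, LinearEquiv.symm_apply_apply]

omit [StarModule ℂ 𝔸] in
/-- The involution is additive. [cite: Balaban1985BackgroundPropagators, (3.11) p.392] -/
theorem starW_add (f g : WL2 ℂ w W) : starW φ (f + g) = starW φ f + starW φ g := by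
  apply (WL2.equiv ℂ w W).injective
  funext i
  simp only [equiv_starW, WL2.equiv_add, Pi.add_apply, map_add, star_add]

/-- The involution is CONJUGATE-linear. [cite: Balaban1985BackgroundPropagators, (3.11) p.392] -/
theorem starW_smul (c : ℂ) (f : WL2 ℂ w W) : starW φ (c • f) = conj c • starW φ f := by
  apply (WL2.equiv ℂ w W).injective
  funext i
  simp only [equiv_starW, WL2.equiv_smul, Pi.smul_apply, map_smul, star_smul, RCLike.star_def]

omit [StarModule ℂ 𝔸] in
/-- `0⋆ = 0`. [cite: Balaban1985BackgroundPropagators, (3.11) p.392] -/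
@[simp] theorem starW_zero : starW φ (0 : WL2 ℂ w W) = 0 := by
  apply (WL2.equiv ℂ w W).injective
  funext i
  simp only [equiv_starW, WL2.equiv_zero, Pi.zero_apply, map_zero, star_zero]

/-- **The real conjugate `T̄ := ⋆ ∘ T ∘ ⋆` of a linear operator** — again `ℂ`-LINEAR (two conjugations). `T` is «real» iff `T̄ = T`.
[cite: Balaban1985BackgroundPropagators, p.390] -/
def realConj {ι' : Type*} {w' : ι' → ℝ} (T : WL2 ℂ w W →ₗ[ℂ] WL2 ℂ w' W) : WL2 ℂ w W →ₗ[ℂ] WL2 ℂ w' W where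
  toFun f := starW φ (T (starW φ f))
  map_add' f g := by rw [starW_add, map_add, starW_add]
  map_smul' c f := by rw [starW_smul, map_smul, starW_smul, RingHom.id_apply, RCLike.conj_conj]

/-- Unfolding. [cite: Balaban1985BackgroundPropagators, p.390] -/
theorem realConj_apply {ι' : Type*} {w' : ι' → ℝ} (T : WL2 ℂ w W →ₗ[ℂ] WL2 ℂ w' W) (f : WL2 ℂ w W) :
    realConj φ T f = starW φ (T (starW φ f)) := rfl

variable (τ : 𝔸 →ₗ[ℂ] ℂ)

/-- **The bilinear TRACE PAIRING `(f, g) := Σ_b w(b)·τ(φf(b)·φg(b))`** of two `W`-valued lattice functions — print's `⟨A, B⟩ = Σ η^d tr A(b)B(b)`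
((3.11), «X·Y = tr XY») read WITHOUT conjugation, i.e. the complex-BILINEAR (analytic) extension of the real pairing; [Balaban1985Variational]'s (27)
is this pairing at `w ≡ η^d`. [cite: Balaban1985BackgroundPropagators, (3.11) p.392; Balaban1985Variational, (27) p.282] -/
def tpair (f g : WL2 ℂ w W) [Fintype ι] : ℂ := ∑ i, (w i : ℂ) * τ (φ (WL2.equiv ℂ w W f i) * φ (WL2.equiv ℂ w W g i))

variable [Fintype ι]

omit [StarRing 𝔸] [StarModule ℂ 𝔸] in
/-- Unfolding. [cite: Balaban1985BackgroundPropagators, (3.11) p.392] -/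
theorem tpair_def (f g : WL2 ℂ w W) : tpair φ τ f g = ∑ i, (w i : ℂ) * τ (φ (WL2.equiv ℂ w W f i) * φ (WL2.equiv ℂ w W g i)) := rfl

omit [StarRing 𝔸] [StarModule ℂ 𝔸] in
/-- For a TRACIAL `τ` the pairing is symmetric. [cite: Balaban1985BackgroundPropagators, (3.11) p.392] -/
theorem tpair_comm (hτ₂ : ∀ X Y : 𝔸, τ (X * Y) = τ (Y * X)) (f g : WL2 ℂ w W) : tpair φ τ f g = tpair φ τ g f := by
  simp only [tpair_def, hτ₂ (φ (WL2.equiv ℂ w W f _))]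

omit [StarRing 𝔸] [StarModule ℂ 𝔸] in
/-- The pairing is additive in the second member. [cite: Balaban1985BackgroundPropagators, (3.11) p.392] -/
theorem tpair_add_right (f g₁ g₂ : WL2 ℂ w W) : tpair φ τ f (g₁ + g₂) = tpair φ τ f g₁ + tpair φ τ f g₂ := by
  simp only [tpair_def, WL2.equiv_add, Pi.add_apply, map_add, mul_add, Finset.sum_add_distrib]

variable [Fact (∀ i, 0 < w i)]

omit [StarModule ℂ 𝔸] in
/-- **THE READING: `(f, g) = ⟪f⋆, g⟫`** — the bilinear pairing is the Hilbert pairing with the first member conjugated, under the cell's norming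
`⟪φ⁻¹X, φ⁻¹Y⟫ = τ(X*Y)`. [cite: Balaban1985BackgroundPropagators, (3.11) p.392] -/
theorem tpair_eq_inner_starW (hφ : ∀ X Y : 𝔸, ⟪φ.symm X, φ.symm Y⟫_ℂ = τ (star X * Y)) (f g : WL2 ℂ w W) :
    tpair φ τ f g = ⟪starW φ f, g⟫_ℂ := by
  have key : ∀ (X : 𝔸) (v : W), ⟪φ.symm X, v⟫_ℂ = τ (star X * φ v) := fun X v => by
    simpa only [LinearEquiv.symm_apply_apply] using hφ X (φ v)
  rw [tpair_def, WL2.inner_def]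
  refine Finset.sum_congr rfl fun i _ => ?_
  rw [equiv_starW, key, star_star]
  rfl

omit [StarModule ℂ 𝔸] in
/-- … and `⟪f, g⟫ = (f⋆, g)`. [cite: Balaban1985BackgroundPropagators, (3.11) p.392] -/
theorem inner_eq_tpair_starW (hφ : ∀ X Y : 𝔸, ⟪φ.symm X, φ.symm Y⟫_ℂ = τ (star X * Y)) (f g : WL2 ℂ w W) :
    ⟪f, g⟫_ℂ = tpair φ τ (starW φ f) g := by
  rw [tpair_eq_inner_starW φ τ hφ, starW_starW]

omit [StarModule ℂ 𝔸] in
/-- **The involution is ANTI-UNITARY for a `*`-trace: `⟪f⋆, g⟫ = conj ⟪f, g⋆⟫`** (`τ(X*) = conj τ(X)`, `τ(XY) = τ(YX)`, real weights).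
[cite: Balaban1985BackgroundPropagators, (3.11) p.392] -/
theorem inner_starW_left (hφ : ∀ X Y : 𝔸, ⟪φ.symm X, φ.symm Y⟫_ℂ = τ (star X * Y)) (hτ₁ : ∀ X : 𝔸, τ (star X) = conj (τ X))
    (hτ₂ : ∀ X Y : 𝔸, τ (X * Y) = τ (Y * X)) (f g : WL2 ℂ w W) : ⟪starW φ f, g⟫_ℂ = conj ⟪f, starW φ g⟫_ℂ := by
  rw [← tpair_eq_inner_starW φ τ hφ, inner_eq_tpair_starW φ τ hφ, tpair_def, tpair_def, map_sum]
  refine Finset.sum_congr rfl fun i _ => ?_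
  rw [map_mul (starRingEnd ℂ), Complex.conj_ofReal, apply_equiv_starW, apply_equiv_starW, ← star_mul, hτ₁, Complex.conj_conj, hτ₂]

end Star

/-! ## §2 The bilinear transpose `Tᵗ := (T̄)†`: `(f, Tᵗg) = (Tf, g)` -/

section Transpose

variable {𝔸 : Type*} [Ring 𝔸] [StarRing 𝔸] [Algebra ℂ 𝔸] [StarModule ℂ 𝔸]
  {W : Type*} [NormedAddCommGroup W] [InnerProductSpace ℂ W] [FiniteDimensional ℂ W] (φ : W ≃ₗ[ℂ] 𝔸) (τ : 𝔸 →ₗ[ℂ] ℂ)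
  {ι ι' : Type*} [Fintype ι] [Fintype ι'] {w : ι → ℝ} {w' : ι' → ℝ} [Fact (∀ i, 0 < w i)] [Fact (∀ i, 0 < w' i)]

/-- **The TRANSPOSE of an operator for the bilinear trace pairing**: `Tᵗ := (⋆T⋆)†` (Hilbert adjoint of the real conjugate).
[cite: Balaban1985BackgroundPropagators, (3.9) p.392, (3.119) p.419] -/
def btrans (T : WL2 ℂ w W →ₗ[ℂ] WL2 ℂ w' W) : WL2 ℂ w' W →ₗ[ℂ] WL2 ℂ w W := LinearMap.adjoint (realConj φ T)

/-- **`(f, Tᵗ g) = (T f, g)`.** [cite: Balaban1985BackgroundPropagators, (3.9) p.392] -/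
theorem tpair_btrans (hφ : ∀ X Y : 𝔸, ⟪φ.symm X, φ.symm Y⟫_ℂ = τ (star X * Y)) (T : WL2 ℂ w W →ₗ[ℂ] WL2 ℂ w' W)
    (f : WL2 ℂ w W) (g : WL2 ℂ w' W) : tpair φ τ f (btrans φ T g) = tpair φ τ (T f) g := by
  rw [tpair_eq_inner_starW φ τ hφ, tpair_eq_inner_starW φ τ hφ, btrans, LinearMap.adjoint_inner_right, realConj_apply, starW_starW]

end Transpose

end Literature.MathematicalPhysics.QuantumFieldTheory.Balaban1983to89.B9Eq311TracePairing

end
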